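import Summits.HodgeConjecture.HodgeConjecture.Theorems.PadicSemiregularLiftHodgeFermatVarietiesGeneralTwinLocal

/-!
# GP without the twin exclusion, III — (L-twin) in level-`N` form and for twin primes

Part 3 of 9 (Sketch Part C tail, ll. 554–616): `even_or_fibre_twoPrime_level` (the same statement for any `N = p · r · n`, transport along `ZMod.castHom`) and
`even_or_fibre_twin_level` (`p ≥ 5` and `p + 2` both prime, `N = p (p+2) n`). Same two `local notation3` as Part 2.

PROVENANCE. Cell hodge-nonav (HUMAN RULING D-0038), planner seat p1 g33: chapter ROUTE-P1AF addenda ADD4 ∕ ADD5 (memos `HOME/memos/ROUTE-P1AF-ADD4.md`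
b7ad80a65555c84d, `…-ADD5.md` ffaf9911041dfeba; referee PASS 0∕0: ref g52 REF-P1AF-ADD4.md 83f6fe06da4ed38e, ref g53 REF-P1AF-ADD5.md bcccb0bceb665800),
frozen Sketch `HOME/p1/route/Sketch_P1AF_RGENTWIN_g33.lean` (sha16 596f05bb769cab0c, 1805 lines, namespaces `HodgeNonAV.P1AF.GenTwin` + the line's
`…CancelByAnyClaimLattice.PairedNull ∕ .CoprimeSix`, farm rc 0 / 0 sorries / axioms {propext, Classical.choice, Quot.sound}; re-elaborated 2026-08-28), split into
nine tree modules `…GeneralTwinSplit` → `…GeneralTwinLocal` → `…GeneralTwinLevel` → `…GeneralTwinLevelOne` → `…GeneralTwinGlue` → `…FibreOfTopLevelGeneralTwinKey` → `…FibreOfTopLevelGeneralTwin` →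
`…FibreOfProgressionGeneralTwin` → `…GeneralTwinPayoff` by planner p1 g34 (landing kit HOME/p1/landing/); proof bodies verbatim (cell namespace renamed
`…Theorems.CancelByAnyClaimLattice.GenTwin`); docstrings reworded per referee rider N-ADD4-1 (Aoki 1983 cites are METHOD attributions; the statements without
the twin exclusion are not in print). Target: lead c4's `CoprimeSix.hodgeConjectureFor_general` (`Theorems/…GeneralPayoff`) WITHOUT the hypothesis
`htwin : ¬ p₁ (p₁+2) ∣ m` — replaced by `(p₁+2)² ∤ m`. Land with `--supports stmt-HodgeConjecture-1334` (line `cancel-by-any-claim-lattice` of crux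
`HodgeFermatVarieties`, route `PadicSemiregularLift`). No instance, no new notation (the `local notation3` of Parts 2, 3 and 9 are the line's, verbatim from
`Theorems/PadicSemiregularLiftHodgeFermatVarietiesFibreOfBoundaryPow` ∕ `…GeneralPayoff`), no sorry, no new axiom.
HONEST SCOPE: the HC pay-off `hodgeConjectureFor_general₂` is MODULO the line's named facts (S0) and stub statements (S2↑, S2↓, S3a, S5), exactly as c4's
`hodgeConjectureFor_general`; Fermat varieties are dominated by abelian motives (inside the known AV region); NOTHING here proves the Hodge conjecture.
References (method): N. Aoki, Math. Ann. 266 (1983) Thm A′ (§7), Prop. 2.2, Prop. 6.4, §9 [cite: Aoki1983, Thm. A]; N. Aoki, J. Math. Soc. Japan 39 (1987)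
Thm 1-1, Thm 2-1 [cite: Aoki1987, Thm. 2-1]; T. Shioda, Proc. Japan Acad. 55 (1979) §2 Thm 1 [cite: Shioda1979PJA, Thm. 1].
-/

set_option linter.dupNamespace false

noncomputable section

namespace Summit.HodgeConjecture.HodgeConjecture.Theorems.CancelByAnyClaimLattice.GenTwin

open Finset
open Literature.AlgebraicGeometry.HodgeTheory Literature.AlgebraicGeometry.HodgeTheory.FermatCharacter
open Summit.HodgeConjecture.HodgeConjecture.Theorems.CancelByAnyClaimLattice
open Summit.HodgeConjecture.HodgeConjecture.Theorems.CancelByAnyClaimLattice.PairedNull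
open Summit.HodgeConjecture.HodgeConjecture.Theorems.CancelByAnyClaimLattice.FiveQ.FourierSplit

section Main

variable {p r n : ℕ} [Fact p.Prime] [Fact r.Prime] [NeZero n]

/-- `πq[p']` — reduction from level `p · r · n` to the prime power `p' ^ v_{p'}(n)` of `n`. Local notation (c2/c4). -/
local notation3 (prettyPrint := false) "πq[" p' "]" =>
  ZMod.castHom ((Nat.ordProj_dvd n p').trans (dvd_mul_left n (p * r))) (ZMod (p' ^ n.factorization p'))

/-- `Reg[P, x, z]` — `z ≡ ±x` modulo `p' ^ v_{p'}(n)` for every `p' ∈ P`. Local notation (c2/c4). -/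
local notation3 (prettyPrint := false) "Reg[" P ", " x ", " z "]" =>
  ∀ p' ∈ (P : Finset ℕ), πq[p'] z = πq[p'] x ∨ πq[p'] z = -(πq[p'] x)

/-- **(L-twin), level-`N` form** — the same statement for any `N = p · r · n`, coordinate maps as `castHom`s (the form
lead c4's `fibre_of_top_level_general` consumes: instantiate `N := p₁ · n'`, `r := p₁ + 2`, `n := n' / (p₁ + 2)`).
(method after [cite: Aoki1983, Prop. 6.4] and Aoki 1983 §9; statement new — cell hodge-nonav P1 g33, memo ROUTE-P1AF-ADD4 — not in print) -/
theorem even_or_fibre_twoPrime_level {N : ℕ} [NeZero N] (hN : N = p * r * n)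
    (hpN : p ∣ N) (hrN : r ∣ N) (hnN : n ∣ N)
    (hp5 : 5 ≤ p) (hr5 : 5 ≤ r) (hprc : p.Coprime r) (hn1 : n ≠ 1)
    (hn5 : ∀ p' ∈ n.primeFactors, 5 ≤ p') (hc : (p * r).Coprime n)
    (T : ZMod N → ℂ) (h01 : ∀ z, T z = 0 ∨ T z = 1) (hTu : ∀ z, ¬ IsUnit z → T z = 0)
    (hT : ∀ χ : DirichletCharacter ℂ N, χ.Odd → χ.IsPrimitive → ∑ z : ZMod N, T z * χ z = 0)
    (hroom : ∀ p' ∈ n.primeFactors, #(univ.filter fun z : ZMod N ↦ T z ≠ 0) + 1 < p')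
    (hsuppT : #(univ.filter fun z : ZMod N ↦ T z ≠ 0) ≤ r - 1) :
    (∀ z, T (-z) = T z) ∨
    (∃ b : ZMod n, IsUnit b ∧ ∃ u₀ : (ZMod p)ˣ, ∀ z : ZMod N, IsUnit z →
        ZMod.castHom hpN (ZMod p) z = u₀ → ZMod.castHom hnN (ZMod n) z = b → T z ≠ 0) ∨
    (∃ b : ZMod n, IsUnit b ∧ ∃ y₀ : (ZMod r)ˣ, ∀ z : ZMod N, IsUnit z →
        ZMod.castHom hrN (ZMod r) z = y₀ → ZMod.castHom hnN (ZMod n) z = b → T z ≠ 0) := by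
  subst hN
  rcases even_or_fibre_twoPrime hp5 hr5 hprc hn1 hn5 hc T h01 hTu hT hroom hsuppT with
    hev | ⟨b, hb, u₀, hrow⟩ | ⟨b, hb, y₀, hcol⟩
  · exact Or.inl hev
  · refine Or.inr (Or.inl ⟨b, hb, u₀, fun z hz hpz hnz ↦ ?_⟩)
    have hnz' : ZMod.castHom (dvd_mul_left n (p * r)) (ZMod n) z = b := hnz
    have hz' := crt_symm_castHom hc z
    rw [hnz'] at hz'
    rw [← hz']
    refine hrow _ (hz.map _) ?_
    rw [← RingHom.comp_apply, ZMod.castHom_comp]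
    exact hpz
  · refine Or.inr (Or.inr ⟨b, hb, y₀, fun z hz hrz hnz ↦ ?_⟩)
    have hnz' : ZMod.castHom (dvd_mul_left n (p * r)) (ZMod n) z = b := hnz
    have hz' := crt_symm_castHom hc z
    rw [hnz'] at hz'
    rw [← hz']
    refine hcol _ (hz.map _) ?_
    rw [← RingHom.comp_apply, ZMod.castHom_comp]
    exact hrz

/-- **(L-twin) for twin primes.** `p ≥ 5` and `p + 2` both prime, `N = p (p+2) n` with `n > 1` coprime to `p (p+2)`
and all its primes `≥ 5`, `T` as above with `#supp T ≤ p + 1`: `T` is even, or a full `(p+2)`-fibre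
`{z unit : z ≡ u₀ (p), z ≡ b (n)}` (`p + 1` points), or a full `p`-fibre `{z unit : z ≡ y₀ (p+2), z ≡ b (n)}`
(`p - 1` points) lies in `supp T`. This is the local lemma R-GEN-twin needs in BOTH bad-prime branches of
lead c4's `fibre_of_top_level_general` (there `#supp T = #S = p₁ + 1`). [cite: Aoki1983, Prop. 6.4 and §9;
cell hodge-nonav P1 g33, ROUTE-P1AF ADD4] -/
theorem even_or_fibre_twin_level {p n N : ℕ} [Fact p.Prime] [Fact (p + 2).Prime] [NeZero n] [NeZero N]
    (hN : N = p * (p + 2) * n) (hpN : p ∣ N) (hrN : p + 2 ∣ N) (hnN : n ∣ N)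
    (hp5 : 5 ≤ p) (hn1 : n ≠ 1) (hn5 : ∀ p' ∈ n.primeFactors, 5 ≤ p') (hc : (p * (p + 2)).Coprime n)
    (T : ZMod N → ℂ) (h01 : ∀ z, T z = 0 ∨ T z = 1) (hTu : ∀ z, ¬ IsUnit z → T z = 0)
    (hT : ∀ χ : DirichletCharacter ℂ N, χ.Odd → χ.IsPrimitive → ∑ z : ZMod N, T z * χ z = 0)
    (hroom : ∀ p' ∈ n.primeFactors, #(univ.filter fun z : ZMod N ↦ T z ≠ 0) + 1 < p')
    (hsuppT : #(univ.filter fun z : ZMod N ↦ T z ≠ 0) ≤ p + 1) :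
    (∀ z, T (-z) = T z) ∨
    (∃ b : ZMod n, IsUnit b ∧ ∃ u₀ : (ZMod p)ˣ, ∀ z : ZMod N, IsUnit z →
        ZMod.castHom hpN (ZMod p) z = u₀ → ZMod.castHom hnN (ZMod n) z = b → T z ≠ 0) ∨
    (∃ b : ZMod n, IsUnit b ∧ ∃ y₀ : (ZMod (p + 2))ˣ, ∀ z : ZMod N, IsUnit z →
        ZMod.castHom hrN (ZMod (p + 2)) z = y₀ → ZMod.castHom hnN (ZMod n) z = b → T z ≠ 0) := by
  have hp : p.Prime := Fact.out
  have hprc : p.Coprime (p + 2) := by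
    rw [Nat.coprime_primes hp Fact.out]
    omega
  exact even_or_fibre_twoPrime_level hN hpN hrN hnN hp5 (by omega) hprc hn1 hn5 hc T h01 hTu hT hroom
    (by simpa using hsuppT)

end Main

end Summit.HodgeConjecture.HodgeConjecture.Theorems.CancelByAnyClaimLattice.GenTwin

end
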